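import Literature.Geometry.Kaehler.ComplexTorusSimpleCMSurfaceEigenframe
import Literature.Geometry.Kaehler.ComplexTorusHodgeGroupProductAlmostQSimpleFactor
import Literature.Geometry.Kaehler.ComplexTorusHodgeLieAlgebraRatNoTypeFour
import Literature.Geometry.Kaehler.ComplexTorusAbelianSurfaceRealMultiplicationHodgeLieAlgebraDimension
import Literature.Geometry.Kaehler.ComplexTorusSimpleAbelianThreefoldTimesSurfaceConditionD
import Literature.NumberTheory.Automorphic.TorusLieAlgebraIntegralSpan
import Literature.NumberTheory.Automorphic.LieAlgebraGLConjReindex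
import Literature.NumberTheory.Automorphic.TorusRigidity
import Literature.NumberTheory.Automorphic.ReductiveGLn
import HarnessLib

/-!
# Moonen–Zarhin 1999 §4: «the torus `U_F` is `ℚ`-simple» — the Hodge group of a SIMPLE complex abelian surface with complex
# multiplication is ALMOST `ℚ`-SIMPLE; hence Lemma (3.6) splits `T × S` for `T` a simple abelian threefold of type IV(1,1)
# (`End⁰(T)` an imaginary quadratic field) and `S` a simple CM surface (Thm. (0.2) (4), §5 (5.10) with `d_min = 2`, `Y₂` not of
# CM type), and condition (D) for such `T × S`

Layer `Literature/Geometry/Kaehler`, namespace `Literature.Geometry.Kaehler.ComplexTorus`; lane `lit-hodgefound` (Track 2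
foundations library), Layer A3∕A4; prover seat `lit-hodgefound-p17`, generation 55, self-proposed row g55-#5 (the first residual
sub-case of ✔ g55-#3 `ComplexTorusSimpleAbelianThreefoldTimesSurfaceConditionD`).  THEOREMS ONLY (no definition, no instance,
no notation, no named fact; D-0026 net debt `0`).

## Sources, VERBATIM (held `paper:arxiv-math_9901113`; locators are page ∕ line of the materialisation)

B. J. J. Moonen, Yu. G. Zarhin [MoonenZarhin1999LowDim], *Hodge classes on abelian varieties of low dimension*, Math. Ann.
**315** (1999) 711–733:
* §4 (4.1) (p0008 L1–L7): «let `F` be a quartic CM-field which does not contain an imaginary quadratic subfield. Then either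
  (1) `F` is Galois over `ℚ`, in which case `Aut(F)` is cyclic of order 4 acting transitively on `Γ_F`, or (2) `F` is not
  Galois over `ℚ`, its normal closure `L` has degree 8 over `ℚ`, and `Aut(F) = {id, ι}`»; proof of Prop. (4.2) (p0008
  L15–L29): «Let `F` be a quartic CM-field not containing an imaginary quadratic subfield. Then the torus `U_F` is `ℚ`-simple.
  Its splitting field is the field `L`.»
* §3 Lemma (3.6) (p0007 L13–L25): «Assume that the Hodge group `Hg(X₂)` is a `ℚ`-simple algebraic torus. (In particular
  `X₂` is of CM-type.) Write `X = X₁ × X₂`. If `Hg(X) ≠ Hg(X₁) × Hg(X₂)` then the center of `Hg(X₁)` contains an algebraic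
  torus which is `ℚ`-isogenous to `Hg(X₂)`.»
* §5 (5.10) (p0010 L18–L29): «First suppose that `d_min = 2`. Then `X ∼ Y₁ × Y₂` where `Y₁` is a simple abelian surface and
  `Y₂` is a simple abelian threefold. Note that `Y₁` is of CM-type with `Hg(Y₁) = U_{F₁}`, where `F₁ = End⁰(Y₁)`. If `Y₂` is
  not of CM-type then Lemma (3.6) readily gives `Hg(X) = Hg(Y₁) × Hg(Y₂)`.»; §2 (2.3) `g = 3` (p0005 L83–L106: Type IV(1,1),
  «`End⁰(X) = F` an imaginary quadratic field … `Hg(X) = U_F(V,φ)`»); Thm. (0.2) (4) (p0002 L1–L8).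
* T. A. Springer [Springer1998], *Linear Algebraic Groups*, 2nd ed., 3.2.7, 4.4.13 («`𝔱 = k ⊗ X_*(T)`»), 11.1.1, 4.4.5–4.4.7.
* A. Borel [Borel1991], *Linear Algebraic Groups*, §8.11 (the `Γ`-action on `X*(T)`; a `ℚ`-torus is `ℚ`-simple iff
  `X*(T) ⊗ ℚ` is an irreducible `Γ`-module).
* H. Lange [Lange2023AbelianVarietiesComplex], §7.2.2 Prop. 7.2.5 (`𝔷(𝒜) ⊆ End⁰(X)`), §7.2.1 (`Hg ⊆ SL(V)`).

## What is proved, and how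

* §1 **`IsSimple.forall_eq_bot_or_eq_of_hodgeGroup_comm_of_finrank_eq_two`** — THE HYPOTHESIS `(hQ)` OF THE TREE («`Hg(S)`
  ALMOST `ℚ`-SIMPLE», p17 g43 `ComplexTorusHodgeGroupProductAlmostQSimpleFactor`) FOR A SIMPLE POLARISED ABELIAN SURFACE `S`
  WITH COMMUTATIVE HODGE GROUP: every Zariski-connected `M ≤ Hg(S)(ℂ)` whose Lie algebra is defined over `ℚ` is `{e}` or
  `Hg(S)(ℂ)`.  PROOF (Moonen–Zarhin's «`U_F` is `ℚ`-simple», read on cocharacters as in p17 g53-#3): in the eigenframe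
  `Hg(S)(ℂ) = P 𝕋_π P⁻¹` of g53-#2, `M` is a subtorus, so `L = {z | P diag(z) P⁻¹ ∈ Lie M} ⊆ A = {z | z ∘ π = -z}` is spanned by
  its INTEGRAL vectors (Springer 4.4.13, the tree's `IsTorusSubgroup.exists_integral_diagonal_span_of_le_diagonal`); `Lie M`,
  the complex span of rational matrices, is `Aut(ℂ)`-stable, so `z ∘ g_σ ∈ L` for integral `z ∈ L`; with the 4-CYCLE `g` of
  g53-#2 (f) («`F` contains no imaginary quadratic field»), a non-zero integral `z₀ ∈ L` and `z₀ ∘ g` span `A` (the file-local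
  `eq_bot_or_forall_mem_of_fourCycle`: `g² = π` on the four lines, and `z₀ ∘ g = λ z₀` would force `λ² = -1` with `λ`
  rational); so `L = 0` (and `M = {e}`, Engine 1 of g43) or `L = A` (and `M = Hg(S)(ℂ)`, Engine 2).
* §2 **`finrank_center_hodgeGroupLieRat_lt_finrank_endAlgRat`** (every complex torus of positive dimension:
  `dim_ℚ 𝔷(𝒜(X)) < dim_ℚ End⁰(X)` — `𝔷(𝒜) = 𝒜 ∩ End⁰` is traceless, `1` is not),
  `IsSimple.finrank_hodgeGroupLieRat_eq_two_of_hodgeGroup_comm_of_finrank_eq_two` (`dim_ℚ 𝒜(S) = 2`).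
* §3 LEMMA (3.6) APPLIED: **`IsSimple.hodgeGroupC_prod_eq_blockDiagProd_of_finrank_center_lt_two_of_hodgeGroup_comm_of_finrank_eq_two`**
  (a simple CM surface `S` splits off every polarised `X₁` with `dim_ℚ 𝔷(𝒜(X₁)) < 2`),
  **`IsSimple.hodgeGroupC_prod_eq_blockDiagProd_of_finrank_centerField_eq_two_of_hodgeGroup_comm_of_finrank_eq_three_two`**
  (`T` a simple threefold with `[Z(End⁰ T) : ℚ] = 2`, i.e. type IV(1,1), `S` a simple CM surface ⟹ `Hg(T × S)(ℂ) = Hg(T)(ℂ) ×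
  Hg(S)(ℂ)` — «if `Y₂` is not of CM-type then Lemma (3.6) readily gives `Hg(X) = Hg(Y₁) × Hg(Y₂)`» for `End⁰(Y₂) = k`), the
  (D)-transfer `IsSimple.forall_divisorClasses_powPeriod_prod_eq_hodgeClasses_of_finrank_centerField_eq_two_of_hodgeGroup_comm_of_finrank_eq_three_two`,
  and THE SHARPER DISPATCH **`IsSimple.forall_divisorClasses_powPeriod_prod_eq_hodgeClasses_of_finrank_eq_three_two_of_isCMField_imp`**
  for `T × S` (both simple): (D) holds whenever the centre of `End⁰(T)` is totally real, or `End⁰(S) = ℚ`, or `T` is of CM type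
  and `S` is not, or `T` is of type IV(1,1) and `S` is of CM type; the RESIDUAL classes (-- TODO(general form): Moonen–Zarhin
  prove them too, (5.8) via Lemma (3.5) and (5.10) via a Galois-group comparison) are `T` of type IV(1,1) × `S` of type I(2) ∕
  II(1), and `T` CM × `S` CM; with its isogeny and «`Hg = Sp_D`» forms.
-/

noncomputable section

open Matrix Module Function NumberField

open scoped MatrixGroups

namespace Literature.Geometry.Kaehler

namespace ComplexTorus

open Literature.NumberTheory.Automorphic (IsZConnected IsTorusSubgroup lieAlgebraGL lieAlgebraGL_mono diagonalSubgroup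
  isMulCommutative_diagonalSubgroup isSemisimpleElt_of_mem_diagonalSubgroup mem_diagonalSubgroup_of_apply_eq_zero
  mem_lieAlgebraGL_map_conj_iff_inv_conj_mem)

/-! ### §0 Plumbing (file-local) -/

section Plumbing

variable {ι : Type*}

/-- Four points: a fixed-point-free involution `π` and two points `j₁`, `j₂ ≠ j₁, π j₁` on a 4-set. [folklore] -/
private theorem four_points₅₅ [Fintype ι] [DecidableEq ι] (hcard : Fintype.card ι = 4) {π : ι → ι} (hπ : Involutive π)
    (hπ' : ∀ j, π j ≠ j) {j₁ j₂ : ι} (h12 : j₁ ≠ j₂) (h12' : j₂ ≠ π j₁) :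
    ∀ j, j = j₁ ∨ j = j₂ ∨ j = π j₁ ∨ j = π j₂ := by
  have h3 : π j₂ ≠ j₁ := fun h ↦ h12' (by rw [← h, hπ j₂])
  have h5 : π j₁ ≠ π j₂ := fun h ↦ h12 (hπ.injective h)
  intro j
  have hS : ({j₁, j₂, π j₁, π j₂} : Finset ι) = Finset.univ := by
    apply Finset.eq_univ_of_card
    have hc : ({j₁, j₂, π j₁, π j₂} : Finset ι).card = 4 := by
      rw [Finset.card_insert_of_notMem (by simp [h12, (hπ' j₁).symm, h3.symm]),
        Finset.card_insert_of_notMem (by simp [(hπ' j₂).symm, h12']),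
        Finset.card_insert_of_notMem (by simp [h5]), Finset.card_singleton]
    rw [hc, hcard]
  have hj' := Finset.mem_univ j
  rw [← hS] at hj'
  simpa only [Finset.mem_insert, Finset.mem_singleton] using hj'

/-- The complex span of a set of rational matrices is stable under the entrywise action of `Aut(ℂ)`. [folklore] -/
private theorem map_ringEquiv_mem_span_ratCast₅₅ (σ : ℂ ≃+* ℂ) (R : Set (Matrix ι ι ℚ)) {Z : Matrix ι ι ℂ}
    (hZ : Z ∈ Submodule.span ℂ ((fun A : Matrix ι ι ℚ ↦ A.map ((↑) : ℚ → ℂ)) '' R)) :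
    Z.map σ ∈ Submodule.span ℂ ((fun A : Matrix ι ι ℚ ↦ A.map ((↑) : ℚ → ℂ)) '' R) := by
  induction hZ using Submodule.span_induction with
  | mem Y hY =>
    obtain ⟨A, hA, rfl⟩ := hY
    have h : (A.map ((↑) : ℚ → ℂ)).map σ = A.map ((↑) : ℚ → ℂ) := by
      ext i j
      simp [Matrix.map_apply]
    rw [h]
    exact Submodule.subset_span ⟨A, hA, rfl⟩
  | zero =>
    rw [Matrix.map_zero _ (map_zero σ)]
    exact zero_mem _
  | add Y Y' _ _ hY hY' =>
    rw [Matrix.map_add _ (map_add σ)]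
    exact add_mem hY hY'
  | smul c Y _ hY =>
    have h : (c • Y).map (σ : ℂ → ℂ) = σ c • Y.map σ := by
      ext i j
      simp [Matrix.map_apply]
    rw [h]
    exact Submodule.smul_mem _ _ hY

variable [Fintype ι] [DecidableEq ι] {P : Matrix ι ι ℂ}

/-- `P (P⁻¹ X P) P⁻¹ = X`. [folklore] -/
private theorem mul_inv_conj_inv₅₅ (hP : IsUnit P.det) (X : Matrix ι ι ℂ) : P * (P⁻¹ * X * P) * P⁻¹ = X := by
  rw [show P * (P⁻¹ * X * P) * P⁻¹ = P * P⁻¹ * X * (P * P⁻¹) by simp only [Matrix.mul_assoc], Matrix.mul_nonsing_inv _ hP,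
    Matrix.one_mul, Matrix.mul_one]

/-- `P⁻¹ (P X P⁻¹) P = X`. [folklore] -/
private theorem inv_mul_conj_mul₅₅ (hP : IsUnit P.det) (X : Matrix ι ι ℂ) : P⁻¹ * (P * X * P⁻¹) * P = X := by
  rw [show P⁻¹ * (P * X * P⁻¹) * P = P⁻¹ * P * X * (P⁻¹ * P) by simp only [Matrix.mul_assoc], Matrix.nonsing_inv_mul _ hP,
    Matrix.one_mul, Matrix.mul_one]

/-- Elements of `P 𝕋_π P⁻¹` are `P diag(d) P⁻¹`. [folklore] -/
private theorem exists_coe_eq_conj_diagonal₅₅ {π : ι → ι} (hπ : Involutive π) (hπ' : ∀ j, π j ≠ j) (hP : IsUnit P.det)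
    {H : Subgroup (SpecialLinearGroup ι ℂ)} (hH : H = (pairedDiagTorus hπ hπ').map (conjGLC P hP).toMonoidHom)
    {M : SpecialLinearGroup ι ℂ} (hM : M ∈ H) : ∃ d : ι → ℂ, (M : Matrix ι ι ℂ) = P * diagonal d * P⁻¹ := by
  rw [hH, Subgroup.mem_map_equiv, mem_pairedDiagTorus_iff, coe_conjGLC_symm] at hM
  obtain ⟨d, -, hM⟩ := hM
  exact ⟨d, by rw [← mul_inv_conj_inv₅₅ hP (M : Matrix ι ι ℂ), hM]⟩

/-- **The cocharacter core of «`U_F` is `ℚ`-simple»**: on a 4-set with a fixed-point-free involution `π` and a permutation `g`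
with `g j₀ = j₀'`, `g j₀' = π j₀` (so `g² = π`), a subspace `L ⊆ {z | z ∘ π = -z}` spanned by its integral vectors and
containing `z ∘ g` with every integral `z ∈ L` is `0` or all of `{z | z ∘ π = -z}` (a non-zero integral `z₀` and `z₀ ∘ g` are
independent: `z₀ ∘ g = λ z₀` would give `λ² = -1` with `λ ∈ ℚ`). [cite: MoonenZarhin1999LowDim, §4 proof of Prop. (4.2) (p0008 L15–L29)]
[cite: Borel1991, §8.11] -/
private theorem eq_bot_or_forall_mem_of_fourCycle₅₅ (hcard : Fintype.card ι = 4) {π : ι → ι} (hπ : Involutive π)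
    (hπ' : ∀ j, π j ≠ j) {g : Equiv.Perm ι} {j₀ j₀' : ι} (hj : j₀ ≠ j₀') (hj' : j₀' ≠ π j₀) (hg₀ : g j₀ = j₀')
    (hg₀' : g j₀' = π j₀) {L : Submodule ℂ (ι → ℂ)} (hLA : ∀ z ∈ L, ∀ j, z (π j) = -z j)
    (hint : L ≤ Submodule.span ℂ {z | z ∈ L ∧ ∀ x, ∃ n : ℤ, z x = n})
    (hstab : ∀ z ∈ L, (∀ x, ∃ n : ℤ, z x = n) → z ∘ g ∈ L) :
    L = ⊥ ∨ ∀ w : ι → ℂ, (∀ j, w (π j) = -w j) → w ∈ L := by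
  classical
  by_cases h0 : ∀ z ∈ L, (∀ x, ∃ n : ℤ, z x = n) → z = 0
  · left
    have hspan : Submodule.span ℂ {z | z ∈ L ∧ ∀ x, ∃ n : ℤ, z x = n} = ⊥ :=
      Submodule.span_eq_bot.2 fun z hz ↦ h0 z hz.1 hz.2
    refine (Submodule.eq_bot_iff _).2 fun z hz ↦ ?_
    have h := hint hz
    rwa [hspan, Submodule.mem_bot] at h
  · right
    push Not at h0
    obtain ⟨z₀, hz₀L, hz₀i, hz₀⟩ := h0
    have hall := four_points₅₅ hcard hπ hπ' hj hj'
    obtain ⟨a, ha⟩ := hz₀i j₀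
    obtain ⟨b, hb⟩ := hz₀i j₀'
    -- `(a, b) ≠ (0, 0)`: otherwise `z₀` vanishes on the four lines
    have hab : (a : ℂ) ^ 2 + (b : ℂ) ^ 2 ≠ 0 := by
      intro h
      have h' : a ^ 2 + b ^ 2 = 0 := by exact_mod_cast h
      have ha2 : a ^ 2 = 0 := by nlinarith [sq_nonneg a, sq_nonneg b]
      have hb2 : b ^ 2 = 0 := by nlinarith [sq_nonneg a, sq_nonneg b]
      have ha0 : a = 0 := (pow_eq_zero_iff two_ne_zero).1 ha2
      have hb0 : b = 0 := (pow_eq_zero_iff two_ne_zero).1 hb2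
      apply hz₀
      funext j
      rcases hall j with rfl | rfl | rfl | rfl
      · rw [ha, ha0]; simp
      · rw [hb, hb0]; simp
      · rw [hLA z₀ hz₀L, ha, ha0]; simp
      · rw [hLA z₀ hz₀L, hb, hb0]; simp
    have hz₁L : z₀ ∘ g ∈ L := hstab z₀ hz₀L hz₀i
    have hz₁0 : (z₀ ∘ g) j₀ = b := by rw [Function.comp_apply, hg₀, hb]
    have hz₁0' : (z₀ ∘ g) j₀' = -a := by rw [Function.comp_apply, hg₀', hLA z₀ hz₀L, ha]
    intro w hw
    -- `w = α z₀ + β (z₀ ∘ g)` with `α = (a w₀ + b w₀')/(a² + b²)`, `β = (b w₀ - a w₀')/(a² + b²)`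
    have hwe : w = (((a : ℂ) * w j₀ + b * w j₀') / ((a : ℂ) ^ 2 + (b : ℂ) ^ 2)) • z₀ +
        (((b : ℂ) * w j₀ - a * w j₀') / ((a : ℂ) ^ 2 + (b : ℂ) ^ 2)) • (z₀ ∘ g) := by
      funext j
      simp only [Pi.add_apply, Pi.smul_apply, smul_eq_mul]
      rcases hall j with rfl | rfl | rfl | rfl
      · rw [ha, hz₁0]
        field_simp
        ring
      · rw [hb, hz₁0']
        field_simp
        ring
      · rw [hw, hLA z₀ hz₀L, hLA (z₀ ∘ g) hz₁L, ha, hz₁0]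
        field_simp
        ring
      · rw [hw, hLA z₀ hz₀L, hLA (z₀ ∘ g) hz₁L, hb, hz₁0']
        field_simp
        ring
    rw [hwe]
    exact L.add_mem (L.smul_mem _ hz₀L) (L.smul_mem _ hz₁L)

end Plumbing

/-! ## §1 The Hodge group of a simple CM surface is almost `ℚ`-simple -/

section AlmostQSimple

variable {κ : Type} [Fintype κ] [DecidableEq κ] {E : Type} [NormedAddCommGroup E] [NormedSpace ℂ E]
  [FiniteDimensional ℂ E] {Ψ : (κ → ℝ) ≃L[ℝ] E} {η : E [⋀^Fin 2]→L[ℝ] ℝ}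

/-- **MOONEN–ZARHIN §4, «THE TORUS `U_F` IS `ℚ`-SIMPLE»: THE HODGE GROUP OF A SIMPLE COMPLEX ABELIAN SURFACE WITH COMPLEX
MULTIPLICATION IS ALMOST `ℚ`-SIMPLE** — for a simple polarised abelian surface `S = E ∕ Ψ(ℤ^κ)` with commutative Hodge group
(`End⁰(S) = F` a quartic CM field with no imaginary quadratic subfield, `Hg(S) = U_F`), every Zariski-connected
`M ≤ Hg(S)(ℂ)`, normalised by `Hg(S)(ℂ)`, whose Lie algebra is defined over `ℚ`, is `{e}` or `Hg(S)(ℂ)` (the tree's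
hypothesis `(hQ)` of `ComplexTorusHodgeGroupProductAlmostQSimpleFactor`).  PROOF: the module docstring (§1).
[cite: MoonenZarhin1999LowDim, §4 (4.1) and proof of Prop. (4.2) (p0008 L1–L29: «Then the torus `U_F` is `ℚ`-simple»), §2 (2.2) `g = 2` Type IV(2,1)]
[cite: Springer1998, 4.4.13, 3.2.7 and 11.1.1] [cite: Borel1991, §8.11] -/
theorem IsSimple.forall_eq_bot_or_eq_of_hodgeGroup_comm_of_finrank_eq_two (hX : IsSimple Ψ) (hη : IsRiemannForm Ψ η)
    (h2 : finrank ℂ E = 2) (hc : ∀ M ∈ hodgeGroup Ψ, ∀ N ∈ hodgeGroup Ψ, M * N = N * M) :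
    ∀ M : Subgroup (GL κ ℂ), IsZConnected M → M ≤ (hodgeGroupC Ψ).map Matrix.SpecialLinearGroup.toGL →
      (∀ g ∈ (hodgeGroupC Ψ).map Matrix.SpecialLinearGroup.toGL, M.map (MulAut.conj g : GL κ ℂ →* GL κ ℂ) = M) →
        (lieAlgebraGL M : Set (Matrix κ κ ℂ)) = Submodule.span ℂ ((fun A : Matrix κ κ ℚ ↦ A.map ((↑) : ℚ → ℂ)) ''
          {A : Matrix κ κ ℚ | A.map ((↑) : ℚ → ℂ) ∈ lieAlgebraGL M}) →
          M = ⊥ ∨ M = (hodgeGroupC Ψ).map Matrix.SpecialLinearGroup.toGL := by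
  classical
  obtain ⟨π, hπ, hπ', P, hP, s, hcard, hHg, hLie, hform, -, hsπ, -, -, σ, g, j₀, j₀', hσ, -, hj, hs0, hs0', hg0, hg0'⟩ :=
    hX.exists_cmEigenframe_of_hodgeGroup_comm_of_finrank_eq_two hη h2 hc
  intro M hM hle _ hdef
  have hj' : j₀' ≠ π j₀ := fun h ↦ by
    have h1 := hsπ j₀
    rw [← h, hs0', hs0] at h1
    norm_num at h1
  -- `L = {z | P diag(z) P⁻¹ ∈ Lie M}`
  obtain ⟨L, hL⟩ : ∃ L : Submodule ℂ (κ → ℂ), ∀ z, z ∈ L ↔ P * diagonal z * P⁻¹ ∈ lieAlgebraGL M :=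
    ⟨(lieAlgebraGL M).comap
      { toFun := fun z ↦ P * diagonal z * P⁻¹
        map_add' := fun a b ↦ by
          rw [show diagonal (a + b) = diagonal a + diagonal b from (diagonal_add a b).symm, Matrix.mul_add, Matrix.add_mul]
        map_smul' := fun c a ↦ by
          rw [RingHom.id_apply, show diagonal (c • a) = c • diagonal a from diagonal_smul c a, Matrix.mul_smul,
            Matrix.smul_mul] },
      fun _ ↦ Iff.rfl⟩
  -- `L ⊆ A = {z | z ∘ π = -z}` (`Lie M ⊆ Lie Hg(S)(ℂ)`)
  have hLA : ∀ z ∈ L, ∀ j, z (π j) = -z j := fun z hz ↦ (hLie z).1 (lieAlgebraGL_mono hle ((hL z).1 hz))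
  -- `M` is a subtorus: `P⁻¹ M P ≤ 𝔻`, so `L` is spanned by its integral vectors
  obtain ⟨P', hP'P⟩ : ∃ P' : GL κ ℂ, (P' : Matrix κ κ ℂ) = P := ⟨Matrix.nonsingInvUnit P hP, rfl⟩
  have hP'inv : ((P'⁻¹ : GL κ ℂ) : Matrix κ κ ℂ) = P⁻¹ := by
    rw [Matrix.coe_units_inv, hP'P]
  set T' := M.map (MulAut.conj P'⁻¹ : GL κ ℂ →* GL κ ℂ) with hT'_def
  have hT'le : T' ≤ diagonalSubgroup κ ℂ := by
    rintro _ ⟨x, hx, rfl⟩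
    obtain ⟨A, hA, rfl⟩ := Subgroup.mem_map.1 (hle hx)
    obtain ⟨d, hd⟩ := exists_coe_eq_conj_diagonal₅₅ hπ hπ' hP hHg hA
    apply mem_diagonalSubgroup_of_apply_eq_zero
    intro i k hik
    rw [MonoidHom.coe_coe, MulAut.conj_apply, inv_inv, Units.val_mul, Units.val_mul, hP'P, hP'inv,
      Matrix.SpecialLinearGroup.coe_GL_coe_matrix, hd, inv_mul_conj_mul₅₅ hP, diagonal_apply_ne _ hik]
  have hcommT' : IsMulCommutative ↥T' := ⟨⟨fun a b ↦ Subtype.ext (by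
    have h : (a : GL κ ℂ) * b = b * a := congrArg Subtype.val
      ((isMulCommutative_diagonalSubgroup (n := κ) (k := ℂ)).is_comm.comm ⟨a.1, hT'le a.2⟩ ⟨b.1, hT'le b.2⟩)
    exact h)⟩⟩
  have hT' : IsTorusSubgroup T' :=
    ⟨hM.map_conj P'⁻¹, hcommT', fun t ht ↦ isSemisimpleElt_of_mem_diagonalSubgroup (hT'le ht)⟩
  have hLT : ∀ z : κ → ℂ, z ∈ L ↔ diagonal z ∈ lieAlgebraGL T' := fun z ↦ by
    rw [hL, hT'_def, mem_lieAlgebraGL_map_conj_iff_inv_conj_mem, inv_inv, hP'P, hP'inv]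
  obtain ⟨r, m, hmLie, hmspan⟩ := hT'.exists_integral_diagonal_span_of_le_diagonal hT'le
  have hint : L ≤ Submodule.span ℂ {z | z ∈ L ∧ ∀ x, ∃ n : ℤ, z x = n} := fun z hz ↦ by
    obtain ⟨cf, hcf⟩ := hmspan (diagonal z) ((hLT z).1 hz)
    have hz' : z = ∑ i, cf i • (fun a ↦ ((m i a : ℤ) : ℂ)) := by
      ext a
      have h := congrFun (congrFun hcf a) a
      rw [diagonal_apply_eq, Matrix.sum_apply] at h
      rw [h, Finset.sum_apply]
      refine Finset.sum_congr rfl fun i _ ↦ ?_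
      rw [Matrix.smul_apply, diagonal_apply_eq, Pi.smul_apply]
    rw [hz']
    exact Submodule.sum_mem _ fun i _ ↦ Submodule.smul_mem _ _
      (Submodule.subset_span ⟨(hLT _).2 (hmLie i), fun x ↦ ⟨m i x, rfl⟩⟩)
  -- `Lie M` is the complex span of rational matrices, hence `Aut(ℂ)`-stable: `z ∘ g ∈ L` for integral `z ∈ L`
  have hstab : ∀ z ∈ L, (∀ x, ∃ n : ℤ, z x = n) → z ∘ g ∈ L := fun z hz hzi ↦ by
    have hσz : ∀ x, σ (z x) = z x := fun x ↦ by
      obtain ⟨n, hn⟩ := hzi x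
      rw [hn, map_intCast]
    have h1 : P * diagonal z * P⁻¹ ∈ (lieAlgebraGL M : Set (Matrix κ κ ℂ)) := (hL z).1 hz
    rw [hdef] at h1
    have h2 := map_ringEquiv_mem_span_ratCast₅₅ σ _ h1
    rw [hσ] at h2
    simp only [hσz] at h2
    have h3 : P * diagonal (fun j ↦ z (g j)) * P⁻¹ ∈ (lieAlgebraGL M : Set (Matrix κ κ ℂ)) := by
      rw [hdef]
      exact h2
    exact (hL _).2 h3
  rcases eq_bot_or_forall_mem_of_fourCycle₅₅ hcard hπ hπ' hj hj' hg0 hg0' hLA hint hstab with hbot | hall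
  · -- `L = 0`: every rational point of `Lie M` vanishes, `M = {e}` (Engine 1)
    refine Or.inl (eq_bot_of_isZConnected_of_forall_map_ratCast_mem_lieAlgebraGL_imp_eq_zero hM hdef fun A hA ↦ ?_)
    obtain ⟨z, hz⟩ := hform _ (lieAlgebraGL_mono hle hA)
    have hzL : z ∈ L := (hL z).2 (by rw [← hz]; exact hA)
    rw [hbot, Submodule.mem_bot] at hzL
    rw [hzL, diagonal_zero', Matrix.mul_zero, Matrix.zero_mul] at hz
    exact Matrix.map_injective Rat.cast_injective (hz.trans (Matrix.map_zero _ Rat.cast_zero).symm)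
  · -- `L = A`: `𝒜(S) ⊗ 1 ⊆ Lie M`, `M = Hg(S)(ℂ)` (Engine 2)
    refine Or.inr (eq_map_toGL_hodgeGroupC_of_isZConnected_of_forall_map_ratCast_mem_lieAlgebraGL Ψ hM hle fun A hA ↦ ?_)
    have hA' := (mem_hodgeGroupLieRat_iff_map_ratCast_mem_lieAlgebraGL Ψ).1 hA
    obtain ⟨z, hz⟩ := hform _ hA'
    have hzA : ∀ j, z (π j) = -z j := (hLie z).1 (by rw [← hz]; exact hA')
    rw [hz]
    exact (hL z).1 (hall z hzA)

end AlmostQSimple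

/-! ## §2 Dimension counts: `dim_ℚ 𝔷(𝒜(X)) < dim_ℚ End⁰(X)`, `dim_ℚ 𝒜(S) = 2` -/

section Dimensions

variable {ι : Type*} [Fintype ι] [DecidableEq ι] {F : Type*} [NormedAddCommGroup F] [NormedSpace ℂ F]
  (Φ : (ι → ℝ) ≃L[ℝ] F)

/-- **`dim_ℚ 𝔷(𝒜(X)) < dim_ℚ End⁰(X)` for every complex torus of positive dimension**: the centre `𝔷(𝒜) = 𝒜 ∩ End⁰(X)`
consists of traceless matrices (`Hg ⊆ SL(V)`), and `1 ∈ End⁰(X)` is not traceless.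
[cite: Lange2023AbelianVarietiesComplex, §7.2.2 Prop. 7.2.5 and §7.2.1 (p. 329)] [cite: MoonenZarhin1999LowDim, §3 Lemma (3.6)] -/
theorem finrank_center_hodgeGroupLieRat_lt_finrank_endAlgRat [Nonempty ι] :
    finrank ℚ (LieAlgebra.center ℚ (hodgeGroupLieRat Φ)) < finrank ℚ (endAlgRat Φ) := by
  letI : LieRing (Matrix ι ι ℚ) := LieRing.ofAssociativeRing
  letI : LieAlgebra ℚ (Matrix ι ι ℚ) := LieAlgebra.ofAssociativeAlgebra
  -- the inclusion `𝔷(𝒜) → M_ι(ℚ)`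
  let f : LieAlgebra.center ℚ (hodgeGroupLieRat Φ) →ₗ[ℚ] Matrix ι ι ℚ :=
    { toFun := fun x ↦ ((x : hodgeGroupLieRat Φ) : Matrix ι ι ℚ)
      map_add' := fun _ _ ↦ rfl
      map_smul' := fun _ _ ↦ rfl }
  have hf : Injective f := fun x y h ↦ Subtype.ext (Subtype.ext h)
  have hle : LinearMap.range f ≤ Subalgebra.toSubmodule (endAlgRat Φ) := by
    rintro _ ⟨x, rfl⟩
    exact (mk_mem_center_hodgeGroupLieRat_iff_mem_endAlgRat (x : hodgeGroupLieRat Φ).2).1 x.2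
  have hne : LinearMap.range f ≠ Subalgebra.toSubmodule (endAlgRat Φ) := fun h ↦ by
    have h1 : (1 : Matrix ι ι ℚ) ∈ LinearMap.range f := by
      rw [h]
      exact Subalgebra.one_mem _
    obtain ⟨x, hx⟩ := h1
    have ht := trace_eq_zero_of_mem_hodgeGroupLieRat (x : hodgeGroupLieRat Φ).2
    have hx' : ((x : hodgeGroupLieRat Φ) : Matrix ι ι ℚ) = 1 := hx
    rw [hx', Matrix.trace_one] at ht
    exact (Nat.cast_ne_zero.2 Fintype.card_ne_zero) ht
  calc finrank ℚ (LieAlgebra.center ℚ (hodgeGroupLieRat Φ)) = finrank ℚ (LinearMap.range f) :=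
      (LinearMap.finrank_range_of_inj hf).symm
    _ < finrank ℚ (Subalgebra.toSubmodule (endAlgRat Φ)) := Submodule.finrank_lt_finrank_of_lt (lt_of_le_of_ne hle hne)
    _ = finrank ℚ (endAlgRat Φ) := Subalgebra.finrank_toSubmodule _

variable {κ : Type} [Fintype κ] [DecidableEq κ] {E : Type} [NormedAddCommGroup E] [NormedSpace ℂ E]
  [FiniteDimensional ℂ E] {Ψ : (κ → ℝ) ≃L[ℝ] E} {η : E [⋀^Fin 2]→L[ℝ] ℝ}

/-- **`dim_ℚ 𝒜(S) = 2` for a simple CM surface** (`dim Hg(S) = dim U_F = 2`).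
[cite: MoonenZarhin1999LowDim, §2 Prop. (2.4) (2) and (2.2) `g = 2` Type IV(2,1)] [cite: Springer1998, §11.1.1] -/
theorem IsSimple.finrank_hodgeGroupLieRat_eq_two_of_hodgeGroup_comm_of_finrank_eq_two (hX : IsSimple Ψ)
    (hη : IsRiemannForm Ψ η) (h2 : finrank ℂ E = 2) (hc : ∀ M ∈ hodgeGroup Ψ, ∀ N ∈ hodgeGroup Ψ, M * N = N * M) :
    finrank ℚ (hodgeGroupLieRat Ψ) = 2 := by
  haveI : Nonempty κ := Fintype.card_pos_iff.1 (by rw [card_eq_two_mul_finrank Ψ, h2]; norm_num)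
  rw [finrank_hodgeGroupLieRat_eq]
  exact (hX.finrank_hodgeGroupLie_eq_two_iff_hodgeGroup_comm_of_finrank_eq_two hη h2).2 hc

/-- **`dim_ℚ End⁰(T) = 2` for a simple threefold of type IV(1,1)** (`End⁰(T) = F`, `[F : ℚ] = 2`).
[cite: MoonenZarhin1999LowDim, §2 (2.3) `g = 3` Type IV(1,1) (p0005 L101–L103)] [cite: Lange2023AbelianVarietiesComplex, §2.6.1 Proposition] -/
theorem IsSimple.finrank_endAlgRat_eq_two_of_finrank_centerField_eq_two_of_finrank_eq_three [Nonempty κ] (hX : IsSimple Ψ)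
    (h3 : finrank ℂ E = 3) (he : finrank ℚ (centerField Ψ hX) = 2) : finrank ℚ (endAlgRat Ψ) = 2 := by
  rw [← finrank_centerField_eq_of_comm hX fun a b ↦ Subtype.ext (hX.endAlgRat_comm_of_finrank_eq_three h3 a a.2 b b.2), he]

end Dimensions

/-! ## §3 Lemma (3.6) applied: `T × S` with `T` of type IV(1,1) and `S` a simple CM surface -/

section SplitOff

variable {ι : Type*} [Fintype ι] [DecidableEq ι] {F : Type*} [NormedAddCommGroup F] [NormedSpace ℂ F]
  {Φ : (ι → ℝ) ≃L[ℝ] F} {ω : F [⋀^Fin 2]→L[ℝ] ℝ}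
  {κ : Type} [Fintype κ] [DecidableEq κ] {E : Type} [NormedAddCommGroup E] [NormedSpace ℂ E]
  [FiniteDimensional ℂ E] {Ψ : (κ → ℝ) ≃L[ℝ] E} {η : E [⋀^Fin 2]→L[ℝ] ℝ}

/-- **A SIMPLE CM SURFACE SPLITS OFF EVERY POLARISED FACTOR WITH `dim_ℚ 𝔷(𝒜(X₁)) < 2`** (Lemma (3.6) contrapositively:
`Hg(S) = U_F` is almost `ℚ`-simple of dimension `2`, and the centre of `Hg(X₁)` is too small to contain a torus isogenous to it):
`Hg(X₁ × S)(ℂ) = Hg(X₁)(ℂ) × Hg(S)(ℂ)`. [cite: MoonenZarhin1999LowDim, §3 Lemma (3.6) (p0007 L13–L25) and §4 proof of Prop. (4.2)]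
[cite: Lange2023AbelianVarietiesComplex, §7.2.3 Prop. 7.2.6] -/
theorem IsSimple.hodgeGroupC_prod_eq_blockDiagProd_of_finrank_center_lt_two_of_hodgeGroup_comm_of_finrank_eq_two
    (hS : IsSimple Ψ) (hη : IsRiemannForm Ψ η) (h2 : finrank ℂ E = 2)
    (hc : ∀ M ∈ hodgeGroup Ψ, ∀ N ∈ hodgeGroup Ψ, M * N = N * M) (hω : IsRiemannForm Φ ω)
    (hlt : finrank ℚ (LieAlgebra.center ℚ (hodgeGroupLieRat Φ)) < 2) :
    hodgeGroupC (prodPeriod Φ Ψ) = blockDiagProd (hodgeGroupC Φ) (hodgeGroupC Ψ) := by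
  haveI : IsLieAbelian (hodgeGroupLieRat Ψ) := (isLieAbelian_hodgeGroupLieRat_iff_hodgeGroup_comm Ψ).2 hc
  exact hω.hodgeGroupC_prod_eq_blockDiagProd_of_almostQSimple_of_finrank_center_lt Ψ
    (hS.forall_eq_bot_or_eq_of_hodgeGroup_comm_of_finrank_eq_two hη h2 hc)
    (by rwa [hS.finrank_hodgeGroupLieRat_eq_two_of_hodgeGroup_comm_of_finrank_eq_two hη h2 hc])

end SplitOff

section ThreefoldTimesSurface

variable {κ₁ κ₂ : Type} [Fintype κ₁] [DecidableEq κ₁] [Nonempty κ₁] [Fintype κ₂] [DecidableEq κ₂] [Nonempty κ₂]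
  {E₁ E₂ : Type} [NormedAddCommGroup E₁] [NormedSpace ℂ E₁] [FiniteDimensional ℂ E₁] [NormedAddCommGroup E₂]
  [NormedSpace ℂ E₂] [FiniteDimensional ℂ E₂] {Ψ₁ : (κ₁ → ℝ) ≃L[ℝ] E₁} {Ψ₂ : (κ₂ → ℝ) ≃L[ℝ] E₂}
  {η₁ : E₁ [⋀^Fin 2]→L[ℝ] ℝ} {η₂ : E₂ [⋀^Fin 2]→L[ℝ] ℝ}

omit [Nonempty κ₂] in
/-- **MOONEN–ZARHIN (5.10), `d_min = 2`, «`Y₂` NOT OF CM-TYPE»: for a simple abelian threefold `T` of type IV(1,1) (`End⁰(T)` an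
imaginary quadratic field: `[Z(End⁰ T) : ℚ] = 2`) and a simple CM surface `S`, `Hg(T × S)(ℂ) = Hg(T)(ℂ) × Hg(S)(ℂ)`** —
`dim_ℚ 𝔷(𝒜(T)) < dim_ℚ End⁰(T) = 2 = dim Hg(S)` and §3's splitting criterion («Lemma (3.6) readily gives
`Hg(X) = Hg(Y₁) × Hg(Y₂)`»). [cite: MoonenZarhin1999LowDim, §5 (5.10) (p0010 L22–L26), §3 Lemma (3.6), §2 (2.3) Type IV(1,1)]
[cite: Lange2023AbelianVarietiesComplex, §7.2.2 Prop. 7.2.5] -/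
theorem IsSimple.hodgeGroupC_prod_eq_blockDiagProd_of_finrank_centerField_eq_two_of_hodgeGroup_comm_of_finrank_eq_three_two
    (hT : IsSimple Ψ₁) (hS : IsSimple Ψ₂) (hη₁ : IsRiemannForm Ψ₁ η₁) (hη₂ : IsRiemannForm Ψ₂ η₂) (h3 : finrank ℂ E₁ = 3)
    (h2 : finrank ℂ E₂ = 2) (he : finrank ℚ (centerField Ψ₁ hT) = 2)
    (hc : ∀ M ∈ hodgeGroup Ψ₂, ∀ N ∈ hodgeGroup Ψ₂, M * N = N * M) :
    hodgeGroupC (prodPeriod Ψ₁ Ψ₂) = blockDiagProd (hodgeGroupC Ψ₁) (hodgeGroupC Ψ₂) :=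
  hS.hodgeGroupC_prod_eq_blockDiagProd_of_finrank_center_lt_two_of_hodgeGroup_comm_of_finrank_eq_two hη₂ h2 hc hη₁
    (lt_of_lt_of_eq (finrank_center_hodgeGroupLieRat_lt_finrank_endAlgRat Ψ₁)
      (hT.finrank_endAlgRat_eq_two_of_finrank_centerField_eq_two_of_finrank_eq_three h3 he))

omit [Nonempty κ₂] in
/-- Real points: `Hg(T × S)(ℝ) = Hg(T)(ℝ) × Hg(S)(ℝ)` for `T` of type IV(1,1) and `S` a simple CM surface.
[cite: MoonenZarhin1999LowDim, §5 (5.10) (p0010 L22–L26) and §3 Lemma (3.6)] -/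
theorem IsSimple.hodgeGroup_prod_eq_of_finrank_centerField_eq_two_of_hodgeGroup_comm_of_finrank_eq_three_two
    (hT : IsSimple Ψ₁) (hS : IsSimple Ψ₂) (hη₁ : IsRiemannForm Ψ₁ η₁) (hη₂ : IsRiemannForm Ψ₂ η₂) (h3 : finrank ℂ E₁ = 3)
    (h2 : finrank ℂ E₂ = 2) (he : finrank ℚ (centerField Ψ₁ hT) = 2)
    (hc : ∀ M ∈ hodgeGroup Ψ₂, ∀ N ∈ hodgeGroup Ψ₂, M * N = N * M) :
    hodgeGroup (prodPeriod Ψ₁ Ψ₂) = ((hodgeGroup Ψ₁).prod (hodgeGroup Ψ₂)).map (blockDiag κ₁ κ₂) :=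
  hodgeGroup_prod_eq_of_hodgeGroupC_prod_eq
    (hT.hodgeGroupC_prod_eq_blockDiagProd_of_finrank_centerField_eq_two_of_hodgeGroup_comm_of_finrank_eq_three_two hS hη₁ hη₂
      h3 h2 he hc)

/-- **CONDITION (D) FOR `T × S`, `T` OF TYPE IV(1,1), `S` A SIMPLE CM SURFACE**: `ℬ•((T × S)ⁿ) = 𝒟•((T × S)ⁿ)` for all `n` —
the Hodge group splits and both factors are stably nondegenerate (abelian varieties of dimension `≤ 3`).
[cite: MoonenZarhin1999LowDim, Thm. (0.2) (4) (p0002 L1–L8), §5 (5.10) (p0010 L22–L26), §3 Thm. (3.2) (2)] [cite: Hazama1983, Lemma (3.1)] -/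
theorem IsSimple.forall_divisorClasses_powPeriod_prod_eq_hodgeClasses_of_finrank_centerField_eq_two_of_hodgeGroup_comm_of_finrank_eq_three_two
    (hT : IsSimple Ψ₁) (hS : IsSimple Ψ₂) (hη₁ : IsRiemannForm Ψ₁ η₁) (hη₂ : IsRiemannForm Ψ₂ η₂) (h3 : finrank ℂ E₁ = 3)
    (h2 : finrank ℂ E₂ = 2) (he : finrank ℚ (centerField Ψ₁ hT) = 2)
    (hc : ∀ M ∈ hodgeGroup Ψ₂, ∀ N ∈ hodgeGroup Ψ₂, M * N = N * M) :
    ∀ k p, divisorClasses (powPeriod (prodPeriod Ψ₁ Ψ₂) k) p = hodgeClasses (powPeriod (prodPeriod Ψ₁ Ψ₂) k) p :=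
  forall_divisorClasses_powPeriod_prod_eq_hodgeClasses_of_hodgeGroupC_prod_eq
    (hT.hodgeGroupC_prod_eq_blockDiagProd_of_finrank_centerField_eq_two_of_hodgeGroup_comm_of_finrank_eq_three_two hS hη₁ hη₂
      h3 h2 he hc)
    (hη₁.forall_divisorClasses_powPeriod_eq_hodgeClasses_of_finrank_eq_three h3)
    (IsAbelianVariety.forall_divisorClasses_powPeriod_eq_hodgeClasses_of_finrank_eq_two ⟨η₂, hη₂⟩ h2)

/-- **THE SHARPER DISPATCH FOR `X = T × S` (BOTH SIMPLE): (D) HOLDS — `ℬ•(Xⁿ) = 𝒟•(Xⁿ)` for all `n` — whenever the centre of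
`End⁰(T)` is totally real (types I(1), I(3): ✔ g55-#3), or `End⁰(S) = ℚ` (✔ g55-#3), or `T` is of CM type and `S` is not
(✔ g55-#3), or `T` IS OF TYPE IV(1,1) AND `S` IS OF CM TYPE (this file).**  The hypothesis `h` names what is NOT covered when
the centre of `End⁰(T)` is a CM field: `T` of type IV(1,1) × `S` of type I(2) ∕ II(1) ((5.8), Lemma (3.5)) and `T` CM ×
`S` CM ((5.10), Galois groups).  -- TODO(general form): those two classes.
[cite: MoonenZarhin1999LowDim, Thm. (0.2) (4) (p0002 L1–L8), §5 (5.6)–(5.10) (p0009 L122 – p0010 L45), §3 Thm. (3.3), Lemma (3.6)]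
[cite: Gordon1999HodgeAVSurvey, Thm. 7.5 and 7.6.2] -/
theorem IsSimple.forall_divisorClasses_powPeriod_prod_eq_hodgeClasses_of_finrank_eq_three_two_of_isCMField_imp
    (hT : IsSimple Ψ₁) (hS : IsSimple Ψ₂) (hη₁ : IsRiemannForm Ψ₁ η₁) (hη₂ : IsRiemannForm Ψ₂ η₂) (h3 : finrank ℂ E₁ = 3)
    (h2 : finrank ℂ E₂ = 2)
    (h : IsCMField (centerField Ψ₁ hT) → endAlgRat Ψ₂ = ⊥ ∨
      ((∀ M ∈ hodgeGroup Ψ₁, ∀ N ∈ hodgeGroup Ψ₁, M * N = N * M) ∧ ¬ ∀ M ∈ hodgeGroup Ψ₂, ∀ N ∈ hodgeGroup Ψ₂, M * N = N * M) ∨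
      (finrank ℚ (centerField Ψ₁ hT) = 2 ∧ ∀ M ∈ hodgeGroup Ψ₂, ∀ N ∈ hodgeGroup Ψ₂, M * N = N * M)) :
    ∀ k p, divisorClasses (powPeriod (prodPeriod Ψ₁ Ψ₂) k) p = hodgeClasses (powPeriod (prodPeriod Ψ₁ Ψ₂) k) p := by
  rcases hT.centerField_isTotallyReal_or_isCMField hη₁ with hR | hCM
  · haveI := hR
    exact hT.forall_divisorClasses_powPeriod_prod_eq_hodgeClasses_of_isTotallyReal_of_finrank_eq_three_two hS hη₁ hη₂ h3 h2
  · rcases h hCM with hE₂ | ⟨hc₁, hnc₂⟩ | ⟨he, hc₂⟩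
    · exact hT.forall_divisorClasses_powPeriod_prod_eq_hodgeClasses_of_endAlgRat_eq_bot_of_finrank_eq_three_two hη₁ hη₂ h3 h2 hE₂
    · exact hS.forall_divisorClasses_powPeriod_prod_eq_hodgeClasses_of_hodgeGroup_comm_of_not_hodgeGroup_comm_of_finrank_eq_three_two
        hη₁ hη₂ h3 h2 hc₁ hnc₂
    · exact hT.forall_divisorClasses_powPeriod_prod_eq_hodgeClasses_of_finrank_centerField_eq_two_of_hodgeGroup_comm_of_finrank_eq_three_two
        hS hη₁ hη₂ h3 h2 he hc₂

end ThreefoldTimesSurface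

section ThreefoldTimesSurfaceIsogenous

variable {ι : Type*} [Fintype ι] [DecidableEq ι] {F : Type*} [NormedAddCommGroup F] [NormedSpace ℂ F]
  {Φ : (ι → ℝ) ≃L[ℝ] F}
  {κ₁ κ₂ : Type} [Fintype κ₁] [DecidableEq κ₁] [Nonempty κ₁] [Fintype κ₂] [DecidableEq κ₂] [Nonempty κ₂]
  {E₁ E₂ : Type} [NormedAddCommGroup E₁] [NormedSpace ℂ E₁] [FiniteDimensional ℂ E₁] [NormedAddCommGroup E₂]
  [NormedSpace ℂ E₂] [FiniteDimensional ℂ E₂] {Ψ₁ : (κ₁ → ℝ) ≃L[ℝ] E₁} {Ψ₂ : (κ₂ → ℝ) ≃L[ℝ] E₂}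
  {η₁ : E₁ [⋀^Fin 2]→L[ℝ] ℝ} {η₂ : E₂ [⋀^Fin 2]→L[ℝ] ℝ}

/-- **Every complex torus ISOGENOUS to such a `T × S` satisfies condition (D)** (the sharper dispatch, transported).
[cite: MoonenZarhin1999LowDim, Thm. (0.2) (4) (p0002 L1–L8) and §5 (5.6)–(5.10)] [cite: Lange2023AbelianVarietiesComplex, §1.1.2 Cor. 1.1.16] -/
theorem IsIsogenous.forall_divisorClasses_powPeriod_eq_hodgeClasses_of_prod_of_finrank_eq_three_two_of_isCMField_imp
    (hiso : IsIsogenous Φ (prodPeriod Ψ₁ Ψ₂)) (hT : IsSimple Ψ₁) (hS : IsSimple Ψ₂) (hη₁ : IsRiemannForm Ψ₁ η₁)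
    (hη₂ : IsRiemannForm Ψ₂ η₂) (h3 : finrank ℂ E₁ = 3) (h2 : finrank ℂ E₂ = 2)
    (h : IsCMField (centerField Ψ₁ hT) → endAlgRat Ψ₂ = ⊥ ∨
      ((∀ M ∈ hodgeGroup Ψ₁, ∀ N ∈ hodgeGroup Ψ₁, M * N = N * M) ∧ ¬ ∀ M ∈ hodgeGroup Ψ₂, ∀ N ∈ hodgeGroup Ψ₂, M * N = N * M) ∨
      (finrank ℚ (centerField Ψ₁ hT) = 2 ∧ ∀ M ∈ hodgeGroup Ψ₂, ∀ N ∈ hodgeGroup Ψ₂, M * N = N * M)) :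
    ∀ k p, divisorClasses (powPeriod Φ k) p = hodgeClasses (powPeriod Φ k) p :=
  hiso.forall_powPeriod_divisorClasses_eq_hodgeClasses_iff.2
    (hT.forall_divisorClasses_powPeriod_prod_eq_hodgeClasses_of_finrank_eq_three_two_of_isCMField_imp hS hη₁ hη₂ h3 h2 h)

/-- **«`Hg(X) = Sp_D(V,φ)`» for `X ∼ T × S` in the enlarged covered classes** (real points, any polarisation `ω` of `X`), from
(D) by Gordon's Thm. 7.5 (1) ⟹ (2). [cite: MoonenZarhin1999LowDim, Thm. (0.2) (4) (p0002 L5–L8)] [cite: Gordon1999HodgeAVSurvey, Thm. 7.5 (1) ⟺ (2)]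
[cite: Milne1999LefschetzClasses, §4 Prop. 4.8] -/
theorem IsRiemannForm.hodgeGroup_eq_lefschetzGroup_of_isIsogenous_prod_of_finrank_eq_three_two_of_isCMField_imp {ι' : Type}
    [Fintype ι'] [DecidableEq ι'] {F' : Type} [NormedAddCommGroup F'] [NormedSpace ℂ F'] [FiniteDimensional ℂ F']
    {Φ' : (ι' → ℝ) ≃L[ℝ] F'} {ω : F' [⋀^Fin 2]→L[ℝ] ℝ} (hω : IsRiemannForm Φ' ω) (hiso : IsIsogenous Φ' (prodPeriod Ψ₁ Ψ₂))
    (hT : IsSimple Ψ₁) (hS : IsSimple Ψ₂) (hη₁ : IsRiemannForm Ψ₁ η₁) (hη₂ : IsRiemannForm Ψ₂ η₂) (h3 : finrank ℂ E₁ = 3)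
    (h2 : finrank ℂ E₂ = 2)
    (h : IsCMField (centerField Ψ₁ hT) → endAlgRat Ψ₂ = ⊥ ∨
      ((∀ M ∈ hodgeGroup Ψ₁, ∀ N ∈ hodgeGroup Ψ₁, M * N = N * M) ∧ ¬ ∀ M ∈ hodgeGroup Ψ₂, ∀ N ∈ hodgeGroup Ψ₂, M * N = N * M) ∨
      (finrank ℚ (centerField Ψ₁ hT) = 2 ∧ ∀ M ∈ hodgeGroup Ψ₂, ∀ N ∈ hodgeGroup Ψ₂, M * N = N * M)) :
    hodgeGroup Φ' = lefschetzGroup Φ' ω := by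
  obtain ⟨G, hG⟩ := hω.exists_ratMatrix_latticeGram
  have h0 : 0 < finrank ℂ F' := by
    have hc := hiso.card_eq
    rw [Fintype.card_sum, card_eq_two_mul_finrank Φ', card_eq_two_mul_finrank Ψ₁, h3] at hc
    omega
  exact ((hω.forall_divisorClasses_powPeriod_eq_hodgeClasses_iff_eq_and_hodgeGroup_eq_lefschetzGroup hG h0).1
    (hiso.forall_divisorClasses_powPeriod_eq_hodgeClasses_of_prod_of_finrank_eq_three_two_of_isCMField_imp hT hS hη₁ hη₂ h3
      h2 h)).2

end ThreefoldTimesSurfaceIsogenous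

end ComplexTorus

end Literature.Geometry.Kaehler
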